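import Summits.BirchSwinnertonDyer.Rank1Residual.X11b.RouteR1IMCEqCoreFrame
import Summits.BirchSwinnertonDyer.Rank1Residual.X11b.BDPValueRigidityInt
import HarnessLib

/-!
# X11b, route R1 at `p ≥ 5` — the `R₀`-FREE open input WITHOUT THE VALUE CONJUNCT (H3∃♭⁻): per
# datum ONE `Q ∈ 𝓞_{ℂ_p}⟦T⟧` with Castella's interpolation property and the main-conjecture equality;
# on SEMISTABLE pairs the value at `𝟙` is supplied from print at every ♭-frame

HONEST FRAMING (cell `b2b-bsdres`, run/shared/lean/b2b/bsd-rank1-residual/, verbatim in every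
file): the goal of the cell is to DELETE the COMBINATION-SHAPED residual classes of the
Birch–Swinnerton-Dyer formula for ALL analytic-rank `≤ 1` elliptic curves over `ℚ` — "full BSD
formula for every rank `≤ 1` curve in class `C`" assembled STRICTLY from published theorems — so
that the rank-`≤ 1` remainder becomes exactly the CONSTRUCTION-SHAPED classes, which are TYPED
(missing-input `Prop`s), NOT attempted. This is not "finishing BSD". Sub-cell
`b2b-bsdres-multr1-p1` (X11b, route R1, gen 25); a RESEARCH ROUTE; no claim beyond the stated
class; X11b stays CONSTRUCTION-SHAPED; nothing here changes a label; ONE `Prop`-valued SHAPE with a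
body (nothing asserted) and theorems; no named fact; no `sorry`; every result using the OPEN shape is
CONDITIONAL.

## Why this file

`RouteR1IMCEqCoreFrame.lean` (this gen) removed the value conjunct from route R1's `R₀`-frame input on
semistable pairs. The `R₀`-FREE attach point of gen 23 (`R1.IMCEqIntFrameOnTree`, H3∃♭: a frame
`Q ∈ 𝓞_{ℂ_p}⟦T⟧` — the currency in which Hsieh's / Castella–Hsieh's object is typed, no rationality
clause) gets the same treatment here, using multr1-p2 GEN 25's value rigidity across periods OVER THE
WIDE RECEPTACLE (`constantCoeff_eq_of_isBDPLFunctionInt_of_isAnticyclotomic`,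
`X11b/BDPValueRigidityInt.lean`; abstract core `intSeries_constantCoeff_eq_of_values_mul_sq`,
`X11b/IntSeriesValueRigidity.lean`) — IMPORTED, not restated:

* §1 **`R1.bdpValueAtOneIntAt_of_isBDPLFunctionInt`** — the H2♭-shape `R1.BDPValueAtOneIntAt` passes
  between ANY two ♭-frames of the same `(ι, 𝔭, κ, γ, f)` (odd `p`, `K` imaginary quadratic, `κ`
  anticyclotomic with topological generator `γ`).
* §2 **`R1.IMCEqIntCoreFrameOnTree W p`** (H3∃♭⁻, OPEN shape, claim-tagged): per datum of route R1
  THERE IS `(Ω_K ≠ 0, Ω_p with ‖Ω_p‖ = 1, Q ∈ 𝓞_{ℂ_p}⟦T⟧)` with `R1.IsBDPLFunctionInt` AND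
  `R1.IMCEqIntAt` — no value conjunct, no rationality clause. It is WEAKER than everything before it:
  `R1.imcEqIntCoreFrameOnTree_of_imcEqIntFrame` (H3∃♭ ⟹ H3∃♭⁻),
  `R1.imcEqIntCoreFrameOnTree_of_imcEqCoreFrame` (H3∃⁻ ⟹ H3∃♭⁻).
* §3 **`R1.imcEqIntFrameOnTree_of_thm32_of_imcEqIntCoreFrame`** — on a SEMISTABLE pair,
  `h32 ∧ H3∃♭⁻ ⟹ H3∃♭`: the published frame (Cas18 Thms. 3.1–3.2, read in `𝓞_{ℂ_p}⟦T⟧`) carries the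
  value at `𝟙`, which transfers to the ♭-frame of H3∃♭⁻ by §1; then gen 23's
  `R1.openInputOnTreeAt_of_imcEqIntFrame'` and the record:
  **`R1.bsdp_of_thm32_of_imcEqIntCoreFrame_record`** — `BSD(E,p)` on SEMISTABLE pairs of
  `R1Population ∩ {r_an = 1}` from 8 PUBLISHED + 5 CITED facts + H3∃♭⁻, whose honest open content is
  "a `Q ∈ 𝓞_{ℂ_p}⟦T⟧` with Castella's interpolation property satisfies erratum Thm. 1.1" — attachable
  to a refereed main conjecture in Castella's OR in Hsieh's / Castella–Hsieh's normalisation (the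
  latter through multr1-p2's glue `exists_isBDPLFunctionInt_of_isHsiehLFunction`: the rescaling by a
  norm-one constant does not change the ideal `(Q)`).

CONDITIONAL on H3∃♭⁻ (open); deletes nothing; X11b stays CONSTRUCTION-SHAPED; no label change.

References: [Castella2018] Thms. 2.3, 3.1, 3.2, §5 (arXiv:1704.06608 pp. 5, 9, 12);
[Castella2018Erratum] Thm. 1.1 (p. 1); [Hsieh2014] p. 7 (the receptacle); [FouquetWan2021] Thm. 4.41.
-/

noncomputable section

open scoped Classical Topology

open Filter WeierstrassCurve NumberField IsDedekindDomain Field PowerSeries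
open Literature.NumberTheory.EllipticCurves Literature.NumberTheory.EllipticCurves.GreenbergSelmer
open Literature.NumberTheory.EllipticCurves.ModularForms
open Literature.NumberTheory.EllipticCurves.Rank1Residual
open Literature.NumberTheory.EllipticCurves.Rank1Residual.Typed
open Literature.NumberTheory.EllipticCurves.Castella2018
open Literature.NumberTheory.GaloisRepresentations
open Literature.NumberTheory.GaloisCohomology
open Summit.BirchSwinnertonDyer.Rank1Residual.X11b.AcSelmer
open Summit.BirchSwinnertonDyer.Rank1Residual.X11b.Halves

namespace Summit.BirchSwinnertonDyer.Rank1Residual.X11b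

/-! ### §1 The H2♭-shape passes between ♭-frames -/

section ValueTransfer

variable {p : ℕ} [Fact p.Prime] {K : Type} [Field K] [NumberField K] {N : ℕ}
  {ι : PadicAlgCl p ≃+* ℂ} {𝔭 : HeightOneSpectrum (𝓞 K)} {κ : ZpExtension K p}
  {γ : Field.absoluteGaloisGroup K} {f : CuspForm (CongruenceSubgroup.Gamma0 N) 2}
  {ΩK ΩK' : ℂ} {Ωp Ωp' : ℂ_[p]} {Q Q' : PowerSeries 𝓞_ℂ_[p]}
  {W : WeierstrassCurve ℚ} [W.IsElliptic] [W.IsGloballyMinimal] {e : K →+* ℚ_[p]}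
  {P : (W.baseChange K).toAffine.Point} {a : ℤ}

/-- **The H2♭-shape passes between ♭-frames.** If one ♭-frame `Q'` of `(ι, 𝔭, κ, γ, f)` has the
Thm. 3.2 value shape `R1.BDPValueAtOneIntAt W p e P Q' a` (`Q'(𝟙) = u·((1 − a p⁻¹) log_{ω_E} P)²`,
`‖u‖ = 1`), then EVERY ♭-frame `Q` of the same data (any non-zero periods) has it: both values at `𝟙`
are the constant terms (`R1.intSeries_hasValueAt_zero`), which agree by multr1-p2's value rigidity
across periods over `𝓞_{ℂ_p}⟦T⟧` (`constantCoeff_eq_of_isBDPLFunctionInt_of_isAnticyclotomic`).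
[cite: Castella2018, Thm. 3.2 (arXiv:1704.06608 p. 9) (shape only; nothing asserted)] -/
theorem R1.bdpValueAtOneIntAt_of_isBDPLFunctionInt (hp2 : p ≠ 2) (hK : IsImaginaryQuadratic K)
    (hκ : κ.IsAnticyclotomic) [hγ : Fact (κ.IsTopGenerator γ)] (hΩK : ΩK ≠ 0) (hΩK' : ΩK' ≠ 0)
    (hΩp : Ωp ≠ 0) (hΩp' : Ωp' ≠ 0) (hQ : R1.IsBDPLFunctionInt p ι 𝔭 κ γ f ΩK Ωp Q)
    (hQ' : R1.IsBDPLFunctionInt p ι 𝔭 κ γ f ΩK' Ωp' Q') (h2 : R1.BDPValueAtOneIntAt W p e P Q' a) :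
    R1.BDPValueAtOneIntAt W p e P Q a := by
  obtain ⟨u, hu, hval⟩ := h2
  refine ⟨u, hu, ?_⟩
  have hc : PowerSeries.constantCoeff Q = PowerSeries.constantCoeff Q' :=
    (constantCoeff_eq_of_isBDPLFunctionInt_of_isAnticyclotomic hp2 hK hκ hγ.out hΩK hΩK' hΩp hΩp'
      hQ hQ').symm
  have hv := R1.intSeries_eq_constantCoeff_of_hasValueAt_zero p hval
  have h0 := R1.intSeries_hasValueAt_zero p Q
  rw [hc, ← hv] at h0
  exact h0

end ValueTransfer

/-! ### §2 The `R₀`-free open input without the value conjunct (H3∃♭⁻) -/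

section Shape

variable (W : WeierstrassCurve ℚ) [W.IsElliptic] [W.IsGloballyMinimal] (p : ℕ) [Fact p.Prime]

/-- **H3∃♭⁻ — route R1's `R₀`-FREE open input WITHOUT THE VALUE CONJUNCT (OPEN shape).** At every datum
of route R1 (exactly the binders of `R1.IMCEqIntFrameOnTree`): THERE EXISTS a frame `(Ω_K ≠ 0,
Ω_p ∈ ℂ_p with ‖Ω_p‖ = 1, Q ∈ 𝓞_{ℂ_p}⟦T⟧)` with Castella's interpolation property
`R1.IsBDPLFunctionInt p ι' 𝔭_{ι'} κ γ f Ω_K Ω_p Q` [Cas18 Thm. 3.1, receptacle widened] AND the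
main-conjecture equality `Ch_Λ(X_ac^∅(E[p^∞]))·𝓞_{ℂ_p}⟦T⟧ = (Q)` [erratum Thm. 1.1, `R1.IMCEqIntAt`]
— no value conjunct, no rationality clause on the coefficient ring: "a `Q` characterised by its
interpolation property satisfies the main conjecture", in whichever normalisation (Castella's
`L_p(f)`, Hsieh's `𝒫_Σ(π,λ)²`, Castella–Hsieh's `ℒ_p(f)`) the refereed statement comes. A predicate
on `(W, p)`; NEVER a theorem in this cell; every result using it is CONDITIONAL.
[claim: Castella2018Erratum, status: under-review]
[cite: Castella2018, Thm. 3.1 and display (3.2) (arXiv:1704.06608 p. 9) (shape only; nothing asserted)]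
[cite: Hsieh2014, p. 7 (arXiv:1112.1580) (the receptacle `Z̄_p⟦Γ⁻⟧ ⊆ 𝓞_{ℂ_p}⟦T⟧`)] -/
def R1.IMCEqIntCoreFrameOnTree : Prop :=
  ∀ [NeZero (W.conductorNorm ℤ)] (q : ℕ) [Fact q.Prime] (K : Type) [Field K] [NumberField K]
    (Dt : ModularParametrizationData W (W.conductorNorm ℤ))
    (H : HeegnerDatum (W.conductorNorm ℤ) (NumberField.discr K)) (w₀ : InfinitePlace K)
    (P : (W.baseChange K).toAffine.Point), ErratumHypotheses W p → W.analyticRank = 1 →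
    q ≠ p → Mult W q → ¬ W.HasSplitMultiplicativeReductionAtPrime q →
    ¬ p ∣ padicValInt q W.minimalDiscriminantInt → IsErratumField W K q →
    Cas20Standing K p (W.conductorNorm ℤ / p) →
    WeierstrassCurve.Affine.Point.map w₀.embedding.toRatAlgHom P = heegnerPointComplex Dt H →
    ¬ (p : ℤ) ∣ Dt.c → ¬ IsOfFinAddOrder P →
    ∀ (κ : ZpExtension K p), κ.IsAnticyclotomic →
      ∀ (γ : Field.absoluteGaloisGroup K) [Fact (κ.IsTopGenerator γ)] (ι' : PadicAlgCl p ≃+* ℂ)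
        (e : K →+* ℚ_[p]),
        (∀ k : 𝓞 K, k ∈ (primeOfEmbeddingDatum p ι' w₀.embedding).asIdeal ↔ ‖e (k : K)‖ < 1) →
        ∃ (ΩK : ℂ) (Ωp : ℂ_[p]) (Q : PowerSeries 𝓞_ℂ_[p]), ΩK ≠ 0 ∧ ‖Ωp‖ = 1 ∧
          R1.IsBDPLFunctionInt p ι' (primeOfEmbeddingDatum p ι' w₀.embedding) κ γ Dt.f ΩK Ωp Q ∧
          R1.IMCEqIntAt W p κ (primeOfEmbeddingDatum p ι' w₀.embedding) γ Q

end Shape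

section Weaker

variable {W : WeierstrassCurve ℚ} [W.IsElliptic] [W.IsGloballyMinimal] {p : ℕ} [Fact p.Prime]

/-- **H3∃♭ ⟹ H3∃♭⁻** (forget the value conjunct). CONDITIONAL on H3∃♭ (open).
[cite: Castella2018, Thm. 3.1 (arXiv:1704.06608 p. 9)] [cite: Castella2018Erratum, Thm. 1.1 (p. 1)] -/
theorem R1.imcEqIntCoreFrameOnTree_of_imcEqIntFrame (h3 : R1.IMCEqIntFrameOnTree W p) :
    R1.IMCEqIntCoreFrameOnTree W p := by
  intro _ q _ K _ _ Dt H w₀ P hE hr hqp hmq hns hvq hK hCas hP hc hinf κ hκ γ _ ι' e he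
  obtain ⟨ΩK, Ωp, Q, hΩ, hΩp, hQ, -, h3At⟩ :=
    h3 q K Dt H w₀ P hE hr hqp hmq hns hvq hK hCas hP hc hinf κ hκ γ ι' e he
  exact ⟨ΩK, Ωp, Q, hΩ, hΩp, hQ, h3At⟩

omit [W.IsElliptic] in
/-- **H3∃⁻ ⟹ H3∃♭⁻** (read the `R₀`-frame in `𝓞_{ℂ_p}⟦T⟧`: `R1.isBDPLFunctionInt_map`,
`R1.imcEqIntAt_map`; `‖Ω_p‖ = 1` for a unit of `R₀`). CONDITIONAL on H3∃⁻ (open).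
[cite: Castella2018, Thm. 3.1 (arXiv:1704.06608 p. 9)] [cite: Castella2018Erratum, Thm. 1.1 (p. 1)] -/
theorem R1.imcEqIntCoreFrameOnTree_of_imcEqCoreFrame (h3 : R1.IMCEqCoreFrameOnTree W p) :
    R1.IMCEqIntCoreFrameOnTree W p := by
  intro _ q _ K _ _ Dt H w₀ P hE hr hqp hmq hns hvq hK hCas hP hc hinf κ hκ γ _ ι' e he
  obtain ⟨ΩK, Ωp, L, hΩ, hL, h3At⟩ :=
    h3 q K Dt H w₀ P hE hr hqp hmq hns hvq hK hCas hP hc hinf κ hκ γ ι' e he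
  exact ⟨ΩK, ((Ωp : unrIntegers p) : ℂ_[p]), PowerSeries.map (R1.unrToCpInt p) L, hΩ,
    norm_coe_units_unrIntegers p Ωp, R1.isBDPLFunctionInt_map hL, R1.imcEqIntAt_map h3At⟩

end Weaker

/-! ### §3 On semistable pairs the value at `𝟙` reaches every ♭-frame; the record -/

section Semistable

variable {W : WeierstrassCurve ℚ} [W.IsElliptic] [W.IsGloballyMinimal] {p : ℕ} [Fact p.Prime]

/-- **On a SEMISTABLE pair, `h32 ∧ H3∃♭⁻ ⟹ H3∃♭`: the value conjunct comes from print at ANY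
♭-frame.** At a datum, H3∃♭⁻ gives `(Ω_K, Ω_p, Q)` with interpolation ∧ main-conjecture equality; the
published fact (Cas18 Thms. 3.1–3.2, `R1.exists_frame_bdpValueAtOneOnTreeAt_of_thm32`) gives an
`R₀`-frame `(Ω_K', Ω_p', L')` of the SAME `(ι', 𝔭_{ι'}, κ, γ, f)` with the value at `𝟙`, read in
`𝓞_{ℂ_p}⟦T⟧` by `R1.isBDPLFunctionInt_map` / `R1.bdpValueAtOneIntAt_map`; by §1 the value shape holds
for `Q` too (`K` imaginary quadratic as an erratum field; `p ≥ 5` odd). CONDITIONAL on the published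
fact `h32` and on H3∃♭⁻ (open). [cite: Castella2018, Thm. 3.1, display (3.2) and Thm. 3.2 (arXiv:1704.06608 p. 9)]
[cite: Castella2018Erratum, Thm. 1.1 (p. 1)] -/
theorem R1.imcEqIntFrameOnTree_of_thm32_of_imcEqIntCoreFrame
    (h32 : thm32_exists_isBDPLFunction_valueAtOne) (hss : Semistable W)
    (h3 : R1.IMCEqIntCoreFrameOnTree W p) : R1.IMCEqIntFrameOnTree W p := by
  intro _ q _ K _ _ Dt H w₀ P hE hr hqp hmq hns hvq hK hCas hP hc hinf κ hκ γ _ ι' e he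
  obtain ⟨ΩK, Ωp, Q, hΩ, hΩp, hQ, h3At⟩ :=
    h3 q K Dt H w₀ P hE hr hqp hmq hns hvq hK hCas hP hc hinf κ hκ γ ι' e he
  obtain ⟨ΩK', Ωp', L', hΩ', hL', h2'⟩ :=
    R1.exists_frame_bdpValueAtOneOnTreeAt_of_thm32 h32 ι' Dt H hE hss hqp hK hc w₀ hP κ hκ γ he
  have hp2 : p ≠ 2 := hE.two_ne
  have hΩp0 : Ωp ≠ 0 := by
    intro h
    rw [h, norm_zero] at hΩp
    exact zero_ne_one hΩp
  have hΩp' : ((Ωp' : unrIntegers p) : ℂ_[p]) ≠ 0 := by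
    rw [Ne, ZeroMemClass.coe_eq_zero]
    exact Units.ne_zero Ωp'
  exact ⟨ΩK, Ωp, Q, hΩ, hΩp, hQ,
    R1.bdpValueAtOneIntAt_of_isBDPLFunctionInt hp2 hK.1 hκ hΩ hΩ' hΩp0 hΩp' hQ
      (R1.isBDPLFunctionInt_map hL') (R1.bdpValueAtOneIntAt_map h2'), h3At⟩

/-- **Route R1 — THE RECORD ON SEMISTABLE PAIRS FROM H3∃♭⁻ (gen 25): `p ≥ 5`, 8 PUBLISHED + 5 CITED +
ONE OPEN input with NO value conjunct and NO rationality clause.** For every SEMISTABLE globally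
minimal elliptic `W/ℚ` and prime `p` on `R1Population` with `ord_{s=1} L(E,s) = 1`: `BSD(E,p)`, from
`hGZ`, `hGZK`, `hSk`, `hmod`, `hCST`, `hFH`, `hMaz`, `h32` (Cas18 Thms. 3.1–3.2), the FIVE CITED
cohomological facts, and the ONE OPEN input `h3 : R1.IMCEqIntCoreFrameOnTree W p` — per datum a
`Q ∈ 𝓞_{ℂ_p}⟦T⟧` with Castella's interpolation property and erratum Thm. 1.1's equality (⇐ [FW21,
Thm. 4.41], PREPRINT), in any published normalisation of the object. CONDITIONAL; deletes nothing;
X11b stays CONSTRUCTION-SHAPED; no label change.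
[cite: Castella2018, §5 (arXiv:1704.06608 p. 12)] [cite: Castella2018Erratum, Thm. 1.1, Thm. A′ (p. 1)] -/
theorem R1.bsdp_of_thm32_of_imcEqIntCoreFrame_record
    (hGZ : GrossZagier1986_thm_I_7_3) (hGZK : rank_eq_analyticRank_of_analyticRank_le_one)
    (hSk : Skinner2016.thmC_padicValRat_bsd_rank_zero) (hmod : exists_isNewformOf)
    (hCST : CaiShuTian2014.thm11_trivialChar)
    (hFH : friedbergHoffstein_exists_twist_ne_zero_ramifiedAt)
    (hMaz : mazur_not_dvd_maninConstant_of_odd) (h32 : thm32_exists_isBDPLFunction_valueAtOne)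
    (hPT : ∀ (K : Type) [Field K] [NumberField K], poitouTate_selmerStructure_duality K)
    (hPT2 : ∀ (K : Type) [Field K] [NumberField K], poitouTate_sha_tateDual K)
    (hEP : ∀ (K : Type) [Field K] [NumberField K] (v : HeightOneSpectrum (𝓞 K)),
      localEulerPoincareCharacteristic (v.adicCompletion K))
    (hcd : fieldCdLE_two_of_numberField)
    (hBr : ∀ (K : Type) [Field K] [NumberField K] (p : ℕ) [Fact p.Prime],
      ZpExtension.decomp_not_le_kerSubgroup_of_isAnticyclotomic K p)
    (hss : Semistable W) (h3 : R1.IMCEqIntCoreFrameOnTree W p) (hW : R1Population W p)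
    (hr : W.analyticRank = 1) : BSDp W p :=
  R1.bsdp_of_imcEqIntFrame_record hGZ hGZK hSk hmod hCST hFH hMaz hPT hPT2 hEP hcd hBr
    (R1.imcEqIntFrameOnTree_of_thm32_of_imcEqIntCoreFrame h32 hss h3) hW hr

/-- **Both sides of gen 19's tightness under `h32 ∧ H3∃♭⁻` on SEMISTABLE pairs.**
CONDITIONAL on H3∃♭⁻ (open). [cite: Castella2018, §5 (arXiv:1704.06608 p. 12)]
[cite: Castella2018Erratum, Thm. 1.1 (p. 1)] -/
theorem R1.openInput_and_bsdp_of_thm32_of_imcEqIntCoreFrame_record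
    (hGZ : GrossZagier1986_thm_I_7_3) (hGZK : rank_eq_analyticRank_of_analyticRank_le_one)
    (hSk : Skinner2016.thmC_padicValRat_bsd_rank_zero) (hmod : exists_isNewformOf)
    (hCST : CaiShuTian2014.thm11_trivialChar)
    (hFH : friedbergHoffstein_exists_twist_ne_zero_ramifiedAt)
    (hMaz : mazur_not_dvd_maninConstant_of_odd) (h32 : thm32_exists_isBDPLFunction_valueAtOne)
    (hPT : ∀ (K : Type) [Field K] [NumberField K], poitouTate_selmerStructure_duality K)
    (hPT2 : ∀ (K : Type) [Field K] [NumberField K], poitouTate_sha_tateDual K)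
    (hEP : ∀ (K : Type) [Field K] [NumberField K] (v : HeightOneSpectrum (𝓞 K)),
      localEulerPoincareCharacteristic (v.adicCompletion K))
    (hcd : fieldCdLE_two_of_numberField)
    (hBr : ∀ (K : Type) [Field K] [NumberField K] (p : ℕ) [Fact p.Prime],
      ZpExtension.decomp_not_le_kerSubgroup_of_isAnticyclotomic K p)
    (hss : Semistable W) (h3 : R1.IMCEqIntCoreFrameOnTree W p) (hW : R1Population W p)
    (hr : W.analyticRank = 1) : R1OpenInputOnTreeAt W p ∧ BSDp W p :=
  R1.openInput_and_bsdp_of_imcEqIntFrame_record hGZ hGZK hSk hmod hCST hFH hMaz hPT hPT2 hEP hcd hBr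
    (R1.imcEqIntFrameOnTree_of_thm32_of_imcEqIntCoreFrame h32 hss h3) hW hr

end Semistable

end Summit.BirchSwinnertonDyer.Rank1Residual.X11b

end
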